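import Literature.AlgebraicGeometry.HodgeTheory.WeilClassesBlochSeed
import Literature.AlgebraicGeometry.HodgeTheory.BlochSemiregularityTheorem
import Literature.AlgebraicGeometry.HodgeTheory.BlochSemiregularCompIso
import Literature.AlgebraicGeometry.HodgeTheory.RegularImmersionIso
import Literature.AlgebraicGeometry.HodgeTheory.RegularImmersionConormal
import Literature.AlgebraicGeometry.HodgeTheory.SupportedClassesPurity
import Mathlib.RingTheory.KrullDimension.Basic

/-!
# Rigid obstruction of a subscheme along a family, and liftability along Weil-type families (PREDICATES + binder logic)

The scheme-level door of Bloch's semiregularity theorem, separated into its two halves so that the NEGATION of Bloch's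
conclusion can be stated: for a smooth projective family `f : 𝒳 → S` over a smooth irreducible base, a point `s₀` and a
closed subscheme `Z₀ ⊂ 𝒳_{s₀}`,
* `HasEtaleLocalFlatLift f s₀ Z₀ i₀` — VERBATIM the `∃`-block concluding `Bloch1972_semiregularSubschemeLifts`
  (an étale `V → S`, a point over `s₀`, a closed `𝒵 ⊆ 𝒳 ×_S V` flat over `V` with `v₀`-fibre `≅ Z₀` compatibly);
* `ClassStaysHodge f n p s₀ i₀` — VERBATIM Bloch's class hypothesis (a support class of `Z₀` is the restriction of a
  global class `W` on `𝒳` whose restrictions to all fibres are Hodge `(p,p)`);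
* `IsBlochFamily n f` / `IsWeilTypeFamily n d f` — Bloch's family-side hypotheses / the same with a fibrewise
  endomorphism of square `-d` (a `√-d`-Weil-type family of abelian-variety fibres is the intended reading);
* `RigidObstructed n p X₀ Z₀ i` / `WeilRigidObstructed n p d P Z₀ i` — «some Bloch (resp. `√-d`-Weil) family through
  `X₀` (resp. `P.X`) along which the class stays Hodge admits NO étale-local flat lift of `Z₀`»;
* `LiftsAlongWeilFamilies n p d P Z₀ i` — the positive form (`↔ ¬ WeilRigidObstructed`, proved Summits-side);
* `not_isBlochSemiregular_of_rigidObstructed` — granting `Bloch1972_semiregularSubschemeLifts`, a rigid-obstructed l.c.i.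
  subscheme of pure codimension `p` is not Bloch-semiregular (Bloch's Thm. (7.4) read contrapositively; proved by
  transport along the chart isomorphism).
The binder logic and the engine live Summits-side (`Summits/HodgeConjecture/HodgeConjecture/Theorems/BlochSeedDiscThree*.lean`).

References: [cite: Bloch1972Semiregularity, Thm. (7.1), Thm. (7.4) and its proof pp. 64–65] [cite: Artin1969, Cor. (2.2)]
[cite: BuchweitzFlenner2003, Thm. 5.1, 5.2] [cite: EGAIV4, Déf. 17.1.1, Prop. 17.14.2 (formally étale; lifting criterion)]
[cite: VoisinHodgeII2003, §5.3.3–5.3.4 (Hodge loci)].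

Provenance: cell `hodge-schoen` round 3 «(R) RIGIDITY» (director-hodge 2026-08-25T19:27:28Z); memos of record
`run/shared/lean/pub/hodge-schoen/memos/ROUND-3-RIGIDITY.md` (85fcfe7848962e66), `ROUND-3-Rigidity.lean` (b3cbc3497475185a, plan g5),
`ROUND-3-RigidityDichotomy.lean` (fd65c70677d60b95, plan g6), `ROUND-3-ADDENDUM-g6.md`; referee audit REFEREE-REPORT.md §J (r1–r5 PASS).
Supports item `stmt-HodgeConjecture-18882` (`EightfoldBlochSeeds.BlochSeedDiscThree := HasHyperbolicBlochSeed 4 3`).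
-/

noncomputable section
open CategoryTheory CategoryTheory.Limits AlgebraicGeometry MonoidalCategory Polynomial
open Literature.AlgebraicGeometry Literature.AlgebraicGeometry.Motives
open Literature.AlgebraicGeometry.Deformation
open Literature.AlgebraicGeometry.HodgeTheory
open Literature.AlgebraicTopology.SingularHomology

namespace Literature.AlgebraicGeometry.HodgeTheory

section Lifts

variable {𝒳 S : SchemeOver ℂ}

/-- **`Z₀ ⊂ X₀ = 𝒳_{s₀}` lifts flatly over an étale neighbourhood of `s₀`** — VERBATIM the `∃`-block concluding
`Bloch1972_semiregularSubschemeLifts`: an étale `π : V ⟶ S`, `v₀ ∈ V(ℂ)` over `s₀`, a closed `𝒵 ⊆ 𝒳 ×_S V`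
FLAT over `V`, and an isomorphism of its `v₀`-fibre with `Z₀` compatible with the inclusions. PREDICATE.
[cite: Bloch1972Semiregularity, Thm. (7.1) and proof of Thm. (7.4)] [cite: Artin1969, Cor. (2.2)] -/
def HasEtaleLocalFlatLift (f : 𝒳 ⟶ S) (s₀ : ComplexPoints S) (Z₀ : Scheme.{0})
    (i₀ : Z₀ ⟶ (fiberOver f s₀).left) : Prop :=
  ∃ (V : SchemeOver ℂ) (π : V ⟶ S) (_ : Etale π.left) (v₀ : ComplexPoints V)
    (_ : AlgPoints.map π v₀ = s₀) (𝒵 : Scheme.{0}) (κ : 𝒵 ⟶ (familyPullback f π).left)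
    (_ : IsClosedImmersion κ) (_ : Flat (κ ≫ (familyPullback.snd f π).left))
    (e : pullback κ (fiberι (familyPullback.snd f π) v₀).left ≅ Z₀),
    pullback.fst κ (fiberι (familyPullback.snd f π) v₀).left ≫ κ ≫ (familyPullback.fst f π).left =
      e.hom ≫ i₀ ≫ (fiberι f s₀).left

end Lifts

section Rigid

variable {𝒳 S : SchemeOver ℂ}

/-- **Bloch's family-side hypotheses**: `f` smooth projective of relative dimension `n`, projective in
Hartshorne's sense (closed in `ℙᴺ × S` over `S`), over a SMOOTH IRREDUCIBLE base. [cite: Bloch1972Semiregularity,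
Thm. (7.4) (hypotheses on f)] -/
def IsBlochFamily (n : ℕ) (f : 𝒳 ⟶ S) : Prop :=
  IsSmoothProjectiveFamily f n ∧
  (∃ (N : ℕ) (ε : 𝒳 ⟶ projectiveSpace N ℂ ⊗ S), IsClosedImmersion ε.left ∧
      ε ≫ CartesianMonoidalCategory.snd (projectiveSpace N ℂ) S = f) ∧
  _root_.AlgebraicGeometry.Smooth S.hom ∧ IrreducibleSpace ↥S.left

/-- **A `√-d`-Weil family**: a Bloch family all of whose fibres are abelian `n`-folds carrying an endomorphism of
square `-d` (VERBATIM the fibre clause of `WeilAnchorLocalClause` / `WeilFamilyReaches`), over a quasi-projective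
base. [cite: vanGeemen1994HodgeAV, 5.2–5.4] [cite: Deligne1982HodgeCycles, proof of Thm. 4.8] -/
def IsWeilTypeFamily (n d : ℕ) (f : 𝒳 ⟶ S) : Prop :=
  IsBlochFamily n f ∧ IsQuasiProjectiveOver S ∧
  (∀ s : ComplexPoints S, ∃ (A'' : AbelianVariety ℂ) (φ'' : A'' ⟶ A''),
      A''.dim = n ∧ φ'' ≫ φ'' = -(d • 𝟙 A'') ∧ Nonempty (A''.X ≅ fiberOver f s))

/-- **Bloch's class hypothesis for `Z₀ ⊂ 𝒳_{s₀}` (via `i₀`)**, verbatim: the class of the closure of every point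
of codimension `p` stays of type `(p,p)` along `f` (`SupportClassStaysHodge`).
[cite: Bloch1972Semiregularity, Thm. (7.1) (hypothesis on the class)] -/
def ClassStaysHodge (f : 𝒳 ⟶ S) (n p : ℕ) (s₀ : ComplexPoints S) {Z₀ : Scheme.{0}}
    (i₀ : Z₀ ⟶ (fiberOver f s₀).left) : Prop :=
  ∀ z : Z₀, Order.coheight (i₀.base z) = (p : ℕ∞) → SupportClassStaysHodge f n p s₀ (closure {i₀.base z})

/-- **(R), family-existence form: `Z₀ ⊂ X₀` is RIGID-OBSTRUCTED in codimension `p`.** There are a Bloch family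
`f : 𝒳 ⟶ S` of relative dimension `n`, a point `s₀` and a chart `e' : X₀ ≅ 𝒳_{s₀}` such that the class of `Z₀`
STAYS HODGE along `f` (Bloch's hypothesis) and yet `Z₀` admits NO flat lift over any étale neighbourhood of `s₀`
(the conclusion of Bloch's theorem FAILS). By `Bloch1972_semiregularSubschemeLifts` such a `Z₀` cannot be
Bloch-semiregular (`not_isBlochSemiregular_of_rigidObstructed`). PREDICATE — the shape of (R).
[cite: Bloch1972Semiregularity, Thm. (7.1), (7.4)] -/
def RigidObstructed (n p : ℕ) (X₀ : SchemeOver ℂ) (Z₀ : Scheme.{0}) (i : Z₀ ⟶ X₀.left) : Prop :=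
  ∃ (𝒳 S : SchemeOver ℂ) (f : 𝒳 ⟶ S) (s₀ : ComplexPoints S) (e' : X₀ ≅ fiberOver f s₀),
    IsBlochFamily n f ∧ ClassStaysHodge f n p s₀ (i ≫ e'.hom.left) ∧
    ¬ HasEtaleLocalFlatLift f s₀ Z₀ (i ≫ e'.hom.left)

/-- **(R) on Weil families: `Z₀ ⊂ P` is rigid-obstructed ALONG A `√-d`-WEIL FAMILY** through the abelian
`n`-fold `P`. [cite: Bloch1972Semiregularity, Thm. (7.4)] [cite: vanGeemen1994HodgeAV, 5.2–5.4] -/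
def WeilRigidObstructed (n p d : ℕ) (P : AbelianVariety ℂ) (Z₀ : Scheme.{0}) (i : Z₀ ⟶ P.X.left) : Prop :=
  ∃ (𝒳 S : SchemeOver ℂ) (f : 𝒳 ⟶ S) (s₀ : ComplexPoints S) (e' : P.X ≅ fiberOver f s₀),
    IsWeilTypeFamily n d f ∧ ClassStaysHodge f n p s₀ (i ≫ e'.hom.left) ∧
    ¬ HasEtaleLocalFlatLift f s₀ Z₀ (i ≫ e'.hom.left)

/-- **Bloch's `π`-door is OBSTRUCTED at a rigid cycle.** Granting the tree's typed Bloch theorem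
`Bloch1972_semiregularSubschemeLifts`: if `Z₀ ⊂ X₀` is rigid-obstructed in codimension `p` and `i` is a regular
immersion of codimension `p` (Bloch's l.c.i. hypothesis) whose image has pure codimension `p` in every chart
(true for `Z₀` integral of codimension `p`), then `Z₀` is NOT Bloch-semiregular in `X₀`: else Bloch's theorem,
applied in the chart `e'` of the obstructing family (transport: `IsBlochSemiregular.comp_iso`,
`IsRegularImmersionOfCodim.comp_iso`, `….isFiniteLocallyFree_conormalSheaf`), would lift it.
[cite: Bloch1972Semiregularity, Thm. (7.1), (7.4)] [cite: Artin1969, Cor. (2.2)] -/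
theorem not_isBlochSemiregular_of_rigidObstructed (hB : Bloch1972_semiregularSubschemeLifts) {n p : ℕ}
    {X₀ : SchemeOver ℂ} {Z₀ : Scheme.{0}} {i : Z₀ ⟶ X₀.left} (hR : RigidObstructed n p X₀ Z₀ i)
    (hreg : IsRegularImmersionOfCodim i p)
    (hpure : ∀ (X₁ : SchemeOver ℂ) (e : X₀ ≅ X₁) (z : Z₀), ∃ z' : Z₀,
      Order.coheight ((i ≫ e.hom.left).base z') = (p : ℕ∞) ∧ (i ≫ e.hom.left).base z' ⤳ (i ≫ e.hom.left).base z) :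
    ¬ IsBlochSemiregular i n p := by
  intro hsr
  obtain ⟨𝒳, S, f, s₀, e', ⟨hf, hproj, hS, -⟩, hclass, hno⟩ := hR
  haveI : IsLocallyNoetherian (fiberOver f s₀).left :=
    IsSmoothProjective.isLocallyNoetherian_holds (hf.isSmoothProjective s₀)
  have hreg' : IsRegularImmersionOfCodim (i ≫ e'.hom.left) p := hreg.comp_iso (leftIso e')
  haveI : IsClosedImmersion (i ≫ e'.hom.left) := hreg'.isClosedImmersion
  exact hno (hB f n p hf hproj hS s₀ Z₀ (i ≫ e'.hom.left) inferInstance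
    hreg'.isFiniteLocallyFree_conormalSheaf (hpure _ e') hclass (IsBlochSemiregular.comp_iso e' i hsr))

/-- **«`Z ⊂ P` LIFTS étale-locally along EVERY `√-d`-Weil family through `P` along which its class stays Hodge»**
— the pointwise NEGATION of (R)'s shape `WeilRigidObstructed`.
What Bloch's theorem (7.4) delivers for a semiregular l.c.i. `Z` (along every Bloch family, a fortiori every Weil
family); here a PREDICATE on `(P, Z)` with no semiregularity inside.
[cite: Bloch1972Semiregularity, Thm. (7.4) (conclusion of the proof, p. 65: Z₀ lifts to an étale neighbourhood of s₀)]
[cite: Artin1969, Cor. (2.2)] -/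
def LiftsAlongWeilFamilies (n p d : ℕ) (P : AbelianVariety ℂ) (Z₀ : Scheme.{0}) (i : Z₀ ⟶ P.X.left) : Prop :=
  ∀ ⦃𝒳' S' : SchemeOver ℂ⦄ (f : 𝒳' ⟶ S') (s₀ : ComplexPoints S') (e' : P.X ≅ fiberOver f s₀),
    IsWeilTypeFamily n d f → ClassStaysHodge f n p s₀ (i ≫ e'.hom.left) →
      HasEtaleLocalFlatLift f s₀ Z₀ (i ≫ e'.hom.left)

end Rigid

end Literature.AlgebraicGeometry.HodgeTheory

end
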